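import Literature.AlgebraicGeometry.ModuliOfAbelianVarieties.SiegelShimuraSetPrincipalDissectionLevel
import HarnessLib

/-!
# The Siegel complex record AT ONE LEVEL from one Siegel fine moduli datum: `Mc_K := ∐_{c ∈ (ℤ/N)^×} Γ_δ(N)∖𝔥_g`
# with its smoothness, quasi-projectivity, complex points `≃ Sh_K(GSp_δ, S^±)(ℂ)`, pieces and uniformisations
# ([Milne ISV] Lemma 5.13 / §6; [MFK94] App. 7A «`𝒜_{g,δ,N} × Spec ℂ ≅ ∐ 𝔥_g/Γ_N`»; [Deligne 1971] 1.8, 4.16)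

Topic `AlgebraicGeometry/ModuliOfAbelianVarieties`; namespace `Literature.AlgebraicGeometry.ModuliOfAbelianVarieties`.
THEOREMS ONLY (no definition, no named fact, no instance, no `sorry`; the record is ∃-packaged).  Cell hodgecm-mathlib
(D-0151), #60 road leaf R60-27d: every field of the hypothesis structure ★ (σ3) `SiegelComplexRecordSystem g δ` AT ONE
LEVEL `K : SiegelLevel δ` — `Mc`, `smooth`, `quasiProjective`, `pts : Mc(ℂ) ≃ SiegelShimuraSet δ K.1`, the piece index
`Q := (ZMod K.N)ˣ` (finite), `rep`, `datum := D`, `incl`, `isColimit`, `incl_unif` — is CONSTRUCTED from ONE Siegel fine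
moduli datum `D : SiegelModuliDatum g δ K.N` (★ `SiegelModuliDatum`, itself the content of Mumford's theorem ★
`mumford1965_siegelFineModuli` at level `K.N`), as `Mc := ∐_c D.S` (Mathlib coproduct in `SchemeOver ℂ`) + the principal
dissection ★ R60-27/27c (`SiegelModuliDatum.exists_sigma_equiv_siegelShimuraSet_level`) + the points of a coproduct ★
`Motives.exists_sigmaHomeomorph_of_isColimit_cofan`.  NOT here: the transition morphisms `Mc_{K′} ⟶ Mc_K` and `map_pts`
(they need the functoriality of Mumford's moduli scheme or Borel's extension theorem — the M2 node of the road).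
HC_CM is proved only modulo the 7 printed citations until rung 0 closes; this file proves no cell binder (books 0).

* §1 (GENERIC, any field `k`) `Motives.smooth_of_isColimit_cofan` — the apex of a colimit cofan of smooth `k`-schemes is
  smooth (Zariski-local at the source; sibling of ★ `smoothOfRelativeDimension_of_isColimit_cofan`);
  `HodgeTheory.isQuasiProjectiveOver_of_isColimit_cofan` — the apex of a colimit cofan of FINITELY many quasi-projective
  `k`-schemes is quasi-projective (open immersion into the coproduct of the projective ambients, which is projective by ★
  `isProjectiveOver_of_isColimit_cofan`; Mathlib `isOpenImmersion_sigmaDesc`).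
* §2 `SiegelModuliDatum.exists_oneLevelRecord` — THE PACKAGE.

## References
* [Milne2005ShimuraVarieties] J. S. Milne, *Introduction to Shimura varieties* (2005), §5 Lemma 5.13 p. 57; §6 p. 70.
* [MumfordFogartyKirwan1994] D. Mumford, J. Fogarty, F. Kirwan, *Geometric Invariant Theory*, Thm. 7.9, Appendix to Ch. 7 §A.
* [Deligne1971TravauxShimura] P. Deligne, *Travaux de Shimura* (1971), 1.8 p. 129, Exemple 4.16 p. 150.
* [GortzWedhorn2020] U. Görtz, T. Wedhorn, *Algebraic Geometry I* (2020), §(3.5) Example 3.11 (disjoint unions), §13 (quasi-projective).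
* [Hartshorne1977] R. Hartshorne, *Algebraic Geometry*, II §4 p. 103, III Prop. 10.1.
-/

set_option autoImplicit false

noncomputable section

open CategoryTheory CategoryTheory.Limits AlgebraicGeometry

universe u

/-! ### §1. Generic: smoothness and quasi-projectivity of finite disjoint unions -/

namespace Literature.AlgebraicGeometry.Motives

section Generic

variable {k : Type u} [Field k] {σ : Type} [Finite σ] {X : σ → SchemeOver k} {S : SchemeOver k} {f : ∀ i, X i ⟶ S}

omit [Finite σ] in
/-- **The apex of a colimit cofan of smooth `k`-schemes is smooth** (the legs are open immersions covering the apex and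
smoothness is Zariski-local at the source). [cite: Hartshorne1977, III Prop. 10.1] [cite: GortzWedhorn2020, §(3.5) Example 3.11 (p. 73)] -/
theorem smooth_of_isColimit_cofan (hc : IsColimit (Cofan.mk S f)) (hX : ∀ i, Smooth (X i).hom) : Smooth S.hom := by
  obtain ⟨hc'⟩ := Morphisms.isColimit_cofan_left hc
  haveI : ∀ i, IsOpenImmersion (f i).left := Morphisms.isOpenImmersion_of_isColimit_cofan hc'
  let 𝒰 : S.left.OpenCover := Scheme.Cover.mkOfCovers σ (fun i => (X i).left) (fun i => (f i).left)
    (fun s => Morphisms.exists_eq_of_isColimit_cofan hc' s)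
  refine IsZariskiLocalAtSource.of_openCover (P := @Smooth) 𝒰 fun i => ?_
  change Smooth ((f i).left ≫ S.hom)
  rw [Over.w (f i)]
  exact hX i

/-- **The apex of a colimit cofan of finitely many quasi-projective `k`-schemes is quasi-projective**: choosing projective
ambients `X i ↪ P i` (open immersions), the induced `S ⟶ ∐ P i` is an open immersion into a projective `k`-scheme
(★ `isProjectiveOver_of_isColimit_cofan`; on underlying schemes it is the coproduct comparison isomorphism followed by
`Sigma.desc` of pairwise disjoint open immersions, Mathlib `isOpenImmersion_sigmaDesc`).
[cite: GortzWedhorn2020, §(3.5) Example 3.11 (p. 73) and §13 (quasi-projective schemes)] [cite: Hartshorne1977, II §4 p. 103; II Ex. 3.12] -/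
theorem _root_.Literature.AlgebraicGeometry.HodgeTheory.isQuasiProjectiveOver_of_isColimit_cofan
    (hc : IsColimit (Cofan.mk S f)) (hX : ∀ i, HodgeTheory.IsQuasiProjectiveOver (X i)) :
    HodgeTheory.IsQuasiProjectiveOver S := by
  classical
  choose P j hP hj using hX
  -- the coproduct of the projective ambients
  have hcP : IsColimit (Cofan.mk (∐ P) (Sigma.ι P)) := coproductIsCoproduct P
  have hPproj : IsProjectiveOver (∐ P) := isProjectiveOver_of_isColimit_cofan hcP hP
  -- the comparison map `J : S ⟶ ∐ P` with `f i ≫ J = j i ≫ ι i`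
  let J : S ⟶ ∐ P := hc.desc (Cofan.mk (∐ P) fun i => j i ≫ Sigma.ι P i)
  have hJ : ∀ i, f i ≫ J = j i ≫ Sigma.ι P i := fun i => hc.fac (Cofan.mk (∐ P) fun i => j i ≫ Sigma.ι P i) ⟨i⟩
  refine ⟨∐ P, J, hPproj, ?_⟩
  -- on underlying schemes
  obtain ⟨hc'⟩ := Morphisms.isColimit_cofan_left hc
  obtain ⟨hcP'⟩ := Morphisms.isColimit_cofan_left hcP
  haveI hιP : ∀ i, IsOpenImmersion (Sigma.ι P i).left := Morphisms.isOpenImmersion_of_isColimit_cofan hcP'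
  have hlegeq : ∀ i, (f i).left ≫ J.left = (j i).left ≫ (Sigma.ι P i).left := fun i => by
    rw [← Over.comp_left, hJ, Over.comp_left]
  haveI hleg : ∀ i, IsOpenImmersion ((f i).left ≫ J.left) := fun i => by
    rw [hlegeq]; infer_instance
  have hdisj : Pairwise (Function.onFun Disjoint fun i => Set.range ((f i).left ≫ J.left)) := by
    intro i i' hii'
    have hd := Morphisms.pairwise_disjoint_range_of_isColimit_cofan hcP' hii'
    refine Set.disjoint_of_subset ?_ ?_ hd
    · rintro _ ⟨x, rfl⟩
      refine ⟨(j i).left x, ?_⟩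
      rw [hlegeq, Scheme.Hom.comp_apply]
    · rintro _ ⟨x, rfl⟩
      refine ⟨(j i').left x, ?_⟩
      rw [hlegeq, Scheme.Hom.comp_apply]
  have hSig : IsOpenImmersion (Sigma.desc fun i => (f i).left ≫ J.left) := isOpenImmersion_sigmaDesc _ _ hdisj
  have hfac : Sigma.desc (fun i => (f i).left) ≫ J.left = Sigma.desc fun i => (f i).left ≫ J.left :=
    Sigma.hom_ext _ _ fun i => by rw [Sigma.ι_desc_assoc, Sigma.ι_desc]
  haveI := Morphisms.isIso_sigmaDesc_of_isColimit_cofan hc'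
  have hJeq : J.left = inv (Sigma.desc fun i => (f i).left) ≫ Sigma.desc fun i => (f i).left ≫ J.left := by
    rw [← hfac, IsIso.inv_hom_id_assoc]
  rw [hJeq]
  infer_instance

end Generic

end Literature.AlgebraicGeometry.Motives

/-! ### §2. The one-level Siegel complex record from one Siegel fine moduli datum -/

namespace Literature.AlgebraicGeometry.ModuliOfAbelianVarieties

open Literature.AlgebraicGeometry.Motives (SchemeOver ComplexPoints AlgPoints)
open Literature.AlgebraicGeometry.HodgeTheory (IsQuasiProjectiveOver)
open Literature.NumberTheory.Automorphic (siegelUpperHalfSpace)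
open SiegelModuli

variable {g : ℕ} {δ : Fin g → ℕ}

/-- **THE SIEGEL COMPLEX RECORD AT ONE LEVEL, CONSTRUCTED** ([Milne ISV] Lemma 5.13 + §6; [MFK94] App. 7A; [Deligne 1971] 1.8,
4.16): for a polarisation type `δ`, `0 < g`, a Siegel level `K = K_δ(N)` (`N = K.N ≥ 3`) and ONE Siegel fine moduli datum
`D : SiegelModuliDatum g δ K.N` (base `D.S(ℂ) = Γ_δ(N)∖𝔥_g`), the `ℂ`-scheme `Mc := ∐_{c ∈ (ℤ/N)^×} D.S` with its coproduct
legs `ι c` is SMOOTH, QUASI-PROJECTIVE, carries a bijection `pts : Mc(ℂ) ≃ Sh_K(GSp_δ, S^±)(ℂ)` and integral representatives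
`rep c ∈ K_δ(1)` such that `(ι c)(ℂ)[X_Z] = pts⁻¹ [J(Z), rep c · K]` for every `Z ∈ 𝔥_g` — i.e. the fields `Mc`, `smooth`,
`quasiProjective`, `pts`, `Q := (ZMod K.N)ˣ`, `rep`, `datum := D`, `incl := ι`, `isColimit`, `incl_unif` of ★ (σ3)
`SiegelComplexRecordSystem g δ` AT THE LEVEL `K`, in the structure's own shapes (the transitions `Mc.map`/`map_pts` are NOT
constructed here).  Inputs by name: ★ R60-27c `exists_sigma_equiv_siegelShimuraSet_level`, ★
`Motives.exists_sigmaHomeomorph_of_isColimit_cofan`, §1. [cite: Milne2005ShimuraVarieties, Lemma 5.13 p. 57 and §6 p. 70]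
[cite: MumfordFogartyKirwan1994, Appendix to Ch. 7 §A] [cite: Deligne1971TravauxShimura, 1.8 p. 129 and Exemple 4.16 p. 150] -/
theorem SiegelModuliDatum.exists_oneLevelRecord (hδ : IsPolarizationType δ) (hg : 0 < g) (K : SiegelLevel δ)
    (D : SiegelModuliDatum g δ K.N) :
    ∃ (Mc : SchemeOver ℂ) (ι : (ZMod K.N)ˣ → (D.S ⟶ Mc)), Nonempty (IsColimit (Cofan.mk Mc ι)) ∧
      Smooth Mc.hom ∧ IsQuasiProjectiveOver Mc ∧
        ∃ (rep : (ZMod K.N)ˣ → gspFinAdelic δ) (pts : ComplexPoints Mc ≃ SiegelShimuraSet δ K.1),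
          (∀ c, rep c ∈ principalLevelSubgroup δ 1) ∧
            ∀ (c : (ZMod K.N)ˣ) (Z : Matrix (Fin g) (Fin g) ℂ) (hJ : jOfSiegel δ Z ∈ C0pm δ),
              Z ∈ siegelUpperHalfSpace g →
                AlgPoints.map (ι c) (D.unif Z) = pts.symm (SiegelShimuraSet.mk δ K.1 ⟨jOfSiegel δ Z, hJ⟩ (rep c)) := by
  classical
  haveI : NeZero K.N := ⟨by have := K.three_le_N; omega⟩
  obtain ⟨u, rep, e, hrep, he⟩ := SiegelModuliDatum.exists_sigma_equiv_siegelShimuraSet_level hδ hg K D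
  let X : (ZMod K.N)ˣ → SchemeOver ℂ := fun _ => D.S
  have hc : IsColimit (Cofan.mk (∐ X) (Sigma.ι X)) := coproductIsCoproduct X
  obtain ⟨Φ, hΦ⟩ := Motives.exists_sigmaHomeomorph_of_isColimit_cofan ℂ hc
  refine ⟨∐ X, Sigma.ι X, ⟨hc⟩, Motives.smooth_of_isColimit_cofan hc (fun _ => D.smooth_base),
    HodgeTheory.isQuasiProjectiveOver_of_isColimit_cofan hc (fun _ => D.isQuasiProjectiveOver_base),
    rep, Φ.toEquiv.symm.trans e, fun c => (hrep c).2.2.1, fun c Z hJ hZ => ?_⟩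
  rw [Equiv.eq_symm_apply, Equiv.trans_apply, ← hΦ c (D.unif Z)]
  have h1 : Φ.toEquiv.symm (Φ ⟨c, D.unif Z⟩) = ⟨c, D.unif Z⟩ := Φ.toEquiv.symm_apply_apply _
  rw [h1]
  exact he c ⟨Z, hZ⟩

end Literature.AlgebraicGeometry.ModuliOfAbelianVarieties

end
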